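import Summits.ResolutionOfSingularities.ResolutionOfSingularities.Theorems.EquisingularLiftEquisingularLiftNatProjectiveSpaceLineDirStepUnobs
import Summits.ResolutionOfSingularities.ResolutionOfSingularities.Theorems.EquisingularLiftEquisingularLiftNatNoseHypUnobsOfOneBlowup
import Summits.ResolutionOfSingularities.ResolutionOfSingularities.Theorems.EquisingularLiftEquisingularLiftNatNoseTowerBTriplePrimeDoubleLine
import Summits.ResolutionOfSingularities.ResolutionOfSingularities.Theorems.EquisingularLiftEquisingularLiftNatSpecimenCayleyRuled
import Summits.ResolutionOfSingularities.ResolutionOfSingularities.Theorems.EquisingularLiftEquisingularLiftNatSpecimenNodalCone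
import Summits.ResolutionOfSingularities.ResolutionOfSingularities.Theorems.EquisingularLiftEquisingularLiftNatSpecimenCuspConeCharts
import Summits.ResolutionOfSingularities.ResolutionOfSingularities.Theorems.EquisingularLiftEquisingularLiftNatNoseResidueClassTwoRegular
import HarnessLib

/-!
# [OURS · L1 W4.5(b) · EL♮(3) · nose residue, brick N-3] ν1 FOR EVERY DOUBLE-LINE HYPERSURFACE WITH REGULAR BLOW-UPS — the generic certificate,
# and three more kernel inhabitants of `NoseHypUnobsBTriplePrime` (Cayley's ruled cubic, the nodal cubic cone, the cuspidal cubic cone)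

Cell `res-hironaka`, LADDER-RESOLUTION rung L (D-0089), slot W4.5(b), crux chain w45b: child crux **EL♮(3)** =
stmt-ResolutionOfSingularities-20148, parent EL♮ = stmt-…-20038; registered nose residue
`stub_elnat_three_nonisolated_nonUnobsNonPointsFirstNoseBTriplePrime` (38th registration), hypothesis `¬ NoseHypUnobsBTriplePrime` ((H-ν1), 37th).
WIDTH seat res-L1-w45b-nose-w1 g2 (D-0157 DOOR 1), follow-up N-3 to the desk booking N-1 (STATUS 2026-08-28T18:04:04Z / 19:10Z offer).
`--supports stmt-ResolutionOfSingularities-20148 --as helper`. OURS; NOT a statement of H. Hironaka's 2017 manuscript (nothing of [Hironaka2017] is asserted);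
AI-written, AI review weaker than expert review. DEF-FREE; no `sorry`; standard axioms. HONESTY: EL♮(3) is NOT proved here; resolution of singularities in
positive characteristic is NOT proved here (dimension 3 is Cossart–Piltant 2008/2009 in print); these are inhabitant certificates of OUR route's named
hypothesis ν1, counted 0 toward the summit.

WHAT.
* `DoubleLine.noseHypUnobsBTriplePrime_of_isRegular_blowups` — the ν1 twin of res-L1-w45b-nose-w3's double-line schema ✓ p645692
  (`DoubleLine.reachNoseTowerBTriplePrime_of_isRegular_blowups`): for a PRIME form `F ∈ (x₂, x₃)` of `K[x₀,…,x₃]` with `x₂ ∉ (F)` and every blow-up of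
  `H = V₊(F)` along `𝓘⟨Σ⟩·𝒪_H` regular, `NoseHypUnobsBTriplePrime K 3 H ι` with the nose `Σ = V₊(x₂, x₃)`: `Σ̃` regular (nose-w4 ✓
  `isRegular_redSub_of_isLiftableNoseClass₂`), `DirStepUnobs ℙ³ univ _ Σ` (res-L1-w45b-nose-w1 ✓ p659452 `P3Line.dirStepUnobs_doubleLine`, the twisted
  producer D3-7 ✓ p655133 on the two standard charts), incidences / infinite / curve (nose-w3 ✓), the one-blow-up regularity
  (`LinearCentre.isRegular_reducedStrictTransform_of_blowupModel`), fed to the zero-round schema ✓ p655634 `noseHypUnobsBTriplePrime_of_oneBlowup`.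
* `CayleyRuled.noseHypUnobsBTriplePrime_cayleyRuled` (`x₀x₂² + x₁x₂x₃ + x₃³`), `NodalCone.noseHypUnobsBTriplePrime_nodalCone` (`(x₀+x₁)x₂x₃ + x₂³ + x₃³`),
  `CuspCone.noseHypUnobsBTriplePrime_cuspCone` (`x₀x₂² − x₃³`): three more kernel inhabitants of ν1 (any field, every characteristic), from
  res-L1-w45b-nose-w3's specimen data ✓ p648222 / ✓ p648583 / ✓ p645415. With ✓ p660042 (the Whitney-type cubic) all four classical double-line cubics
  of nose-w3's census are in ν1 as well as in the B‴ class₂ predicate.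

References (index only): R. Hartshorne, *Algebraic Geometry* (1977), II §7, III Ex. 4.5 [cite: Hartshorne1977].
-/

set_option linter.dupNamespace false -- mandated namespace `Summit.<Summit>.<Problem>` of this single-conjunct summit

noncomputable section

open CategoryTheory CategoryTheory.Limits AlgebraicGeometry TopologicalSpace
open MvPolynomial HomogeneousLocalization
open Literature.AlgebraicGeometry.Resolution
open Literature.AlgebraicGeometry.Motives Literature.AlgebraicGeometry.Motives.SmoothHypersurface
open Literature.AlgebraicGeometry.Motives.ProjectiveSpace
open AlgebraicGeometry.Scheme.IdealSheafData

namespace Summit.ResolutionOfSingularities.ResolutionOfSingularities.Cruxes.EquisingularLiftNat.Sections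

namespace DoubleLine

variable (K : Type) [Field K]

/-- ★★ **ν1 FOR DOUBLE-LINE HYPERSURFACES WITH REGULAR BLOW-UPS** (any field `K`): for a prime form `F ∈ (x₂, x₃)` with `x₂ ∉ (F)` such that every blow-up of
`H = V₊(F)` along `𝓘⟨Σ⟩·𝒪_H` (`Σ = V₊(x₂, x₃)`) is regular, `NoseHypUnobsBTriplePrime K 3 H ι` — nose `Σ`, `Σ̃` regular, `Ȟ¹(Σ̃, 𝒩_{Σ̃/ℙ³}) = 0`
(`P3Line.dirStepUnobs_doubleLine`), one blow-up, empty round phase. The ν1 twin of `reachNoseTowerBTriplePrime_of_isRegular_blowups`.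
[OURS · L1 W4.5b · EL♮(3) · N-3; NOT a statement of the manuscript; EL♮(3) NOT proved] -/
theorem noseHypUnobsBTriplePrime_of_isRegular_blowups (F : MvPolynomial (Fin 4) K) {e : ℕ} (hF : F.IsHomogeneous e) (hprime : Prime F)
    (hmem : F ∈ Ideal.span {(X 2 : MvPolynomial (Fin 4) K), X 3})
    (hX2 : (X 2 : MvPolynomial (Fin 4) K) ∉ Ideal.span {F})
    (hreg : ∀ (Z : Scheme.{0}) (ρ : Z ⟶ (hypersurface F).left),
      IsBlowup ρ ((vanishingIdeal (⟨_, WhitneyCubic.isClosed_doubleLine K⟩ :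
        Closeds (Literature.AlgebraicGeometry.Motives.projectiveSpace 3 K).left)).comap (hypersurfaceι F).left) →
      Scheme.IsRegular Z) :
    NoseHypUnobsBTriplePrime K 3 (hypersurface F).left (hypersurfaceι F).left := by
  classical
  letI := MvPolynomial.gradedAlgebra (σ := Fin (1 + 2 + 1)) (R := K)
  letI := MvPolynomial.gradedAlgebra (σ := Fin (1 + 1)) (R := K)
  obtain ⟨fk, hfk', hfkC, hfkX⟩ := EquisingularLift.StrataSplit.LinearCentre.exists_kill K 1 2
  haveI := isIntegral_hypersurface_of_prime K F hF hprime
  haveI : IsLocallyNoetherian (Literature.AlgebraicGeometry.Motives.projectiveSpace (2 + 1) K).left :=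
    EquisingularLift.StrataSplit.LinearCentre.isLocallyNoetherian_proj K (1 + 2)
  -- a blow-up of `ℙ³_K` along `Λ = ker Proj(f_K) = 𝓘(Σ)`
  obtain ⟨F₂, υ, hυ⟩ := exists_isBlowup (Proj (homogeneousSubmodule (Fin (1 + 2 + 1)) K)) (Proj.map fk hfk').ker
  have hΛ := WhitneyCubic.ker_projMap_kill_eq_vanishingIdeal_doubleLine K fk hfk' hfkC hfkX (WhitneyCubic.isClosed_doubleLine K)
  have hsupp := WhitneyCubic.support_ker_projMap_kill_eq_doubleLine K fk hfk' hfkC hfkX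
  have hnot : ¬ (Set.range (hypersurfaceι F).left ⊆
      ((Proj.map fk hfk').ker.support : Set (Proj (homogeneousSubmodule (Fin (1 + 2 + 1)) K)))) := by
    rw [hsupp]
    exact not_range_subset_of_notMem K F hF hprime hX2
  have hreg' : ∀ (Z : Scheme.{0}) (ρ : Z ⟶ (hypersurface F).left),
      IsBlowup ρ (((Proj.map fk hfk').ker).comap (hypersurfaceι F).left) → Scheme.IsRegular Z := by
    rw [hΛ]
    exact hreg
  -- the reduced strict transform is regular
  have hregST : Scheme.IsRegular (vanishingIdeal (⟨closure (υ ⁻¹' (Set.range (hypersurfaceι F).left \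
      ((Proj.map fk hfk').ker.support : Set (Proj (homogeneousSubmodule (Fin (1 + 2 + 1)) K))))), isClosed_closure⟩ :
      Closeds F₂)).subscheme :=
    EquisingularLift.StrataSplit.LinearCentre.isRegular_reducedStrictTransform_of_blowupModel (hypersurfaceι F).left
      (Proj.map fk hfk').ker hnot hreg' υ hυ
  rw [hsupp] at hregST
  rw [hΛ] at hυ
  -- `Σ̃` is regular: `Σ` is a line, hence class₂
  have hZreg := isRegular_redSub_of_isLiftableNoseClass₂ K 3
    (IsLiftableNoseClass₂.base _ (SkewLines.line_isLiftableNoseClass K 2 3 0 (by decide) (by decide) (by decide)))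
    (WhitneyCubic.isClosed_doubleLine K)
  exact noseHypUnobsBTriplePrime_of_oneBlowup K 3 _ (hypersurfaceι F).left _ (WhitneyCubic.isClosed_doubleLine K)
    (fun x => hZreg x) (P3Line.dirStepUnobs_doubleLine K)
    (subset_range_of_mem_span K F hmem) (not_range_subset_of_notMem K F hF hprime hX2) (WhitneyCubic.doubleLine_infinite K)
    (WhitneyCubic.doubleLine_curve K) F₂ υ hυ hregST

end DoubleLine

/-- ★ **CAYLEY'S RULED CUBIC `x₀x₂² + x₁x₂x₃ + x₃³` IS IN ν1** (any field, every characteristic): `NoseHypUnobsBTriplePrime K 3 H ι` by the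
double-line ν1 schema on res-L1-w45b-nose-w3's data (✓ p648222). [OURS · L1 W4.5b · EL♮(3) · N-3; NOT a statement of the manuscript] -/
theorem CayleyRuled.noseHypUnobsBTriplePrime_cayleyRuled (K : Type) [Field K] :
    NoseHypUnobsBTriplePrime K 3 (hypersurface (CayleyRuled.form K)).left (hypersurfaceι (CayleyRuled.form K)).left :=
  DoubleLine.noseHypUnobsBTriplePrime_of_isRegular_blowups K (CayleyRuled.form K) (CayleyRuled.isHomogeneous_form K) (CayleyRuled.prime_form K)
    (CayleyRuled.form_mem_span K) (CayleyRuled.X_two_not_mem_span_form K) (CayleyRuled.isRegular_blowups K)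

/-- ★ **THE NODAL CUBIC CONE `(x₀+x₁)x₂x₃ + x₂³ + x₃³` IS IN ν1** (any field, every characteristic): `NoseHypUnobsBTriplePrime K 3 H ι` by the
double-line ν1 schema on res-L1-w45b-nose-w3's data (✓ p648583). [OURS · L1 W4.5b · EL♮(3) · N-3; NOT a statement of the manuscript] -/
theorem NodalCone.noseHypUnobsBTriplePrime_nodalCone (K : Type) [Field K] :
    NoseHypUnobsBTriplePrime K 3 (hypersurface (NodalCone.form K)).left (hypersurfaceι (NodalCone.form K)).left :=
  DoubleLine.noseHypUnobsBTriplePrime_of_isRegular_blowups K (NodalCone.form K) (NodalCone.isHomogeneous_form K) (NodalCone.prime_form K)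
    (NodalCone.form_mem_span K) (NodalCone.X_two_not_mem_span_form K) (NodalCone.isRegular_blowups K)

namespace CuspCone

/-- ★ **THE CUSPIDAL CUBIC CONE `x₀x₂² − x₃³` IS IN ν1** (any field, every characteristic): `NoseHypUnobsBTriplePrime K 3 H ι` — nose-w3's zero-round
data (✓ p645415: `isRegular_of_isBlowup_comap`, `doubleLine_subset_range_ι`, `not_range_ι_subset_doubleLine`) fed to the ν1 schema with
`P3Line.dirStepUnobs_doubleLine` and `isRegular_redSub_of_isLiftableNoseClass₂`. [OURS · L1 W4.5b · EL♮(3) · N-3; NOT a statement of the manuscript] -/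
theorem noseHypUnobsBTriplePrime_cuspCone (K : Type) [Field K] :
    NoseHypUnobsBTriplePrime K 3 (hypersurface (CuspCone.form K)).left (hypersurfaceι (CuspCone.form K)).left := by
  classical
  letI := MvPolynomial.gradedAlgebra (σ := Fin (1 + 2 + 1)) (R := K)
  letI := MvPolynomial.gradedAlgebra (σ := Fin (1 + 1)) (R := K)
  obtain ⟨fk, hfk', hfkC, hfkX⟩ := EquisingularLift.StrataSplit.LinearCentre.exists_kill K 1 2
  haveI := isIntegral_hypersurface K
  haveI : IsLocallyNoetherian (Literature.AlgebraicGeometry.Motives.projectiveSpace (2 + 1) K).left :=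
    EquisingularLift.StrataSplit.LinearCentre.isLocallyNoetherian_proj K (1 + 2)
  obtain ⟨F₂, υ, hυ⟩ := exists_isBlowup (Proj (homogeneousSubmodule (Fin (1 + 2 + 1)) K)) (Proj.map fk hfk').ker
  have hΛ := WhitneyCubic.ker_projMap_kill_eq_vanishingIdeal_doubleLine K fk hfk' hfkC hfkX (WhitneyCubic.isClosed_doubleLine K)
  have hsupp := WhitneyCubic.support_ker_projMap_kill_eq_doubleLine K fk hfk' hfkC hfkX
  have hreg : Scheme.IsRegular (vanishingIdeal (⟨closure (υ ⁻¹' (Set.range (hypersurfaceι (CuspCone.form K)).left \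
      ((Proj.map fk hfk').ker.support : Set (Proj (homogeneousSubmodule (Fin (1 + 2 + 1)) K))))), isClosed_closure⟩ :
      Closeds F₂)).subscheme :=
    EquisingularLift.StrataSplit.LinearCentre.isRegular_reducedStrictTransform_of_blowupModel (hypersurfaceι (CuspCone.form K)).left
      (Proj.map fk hfk').ker (not_range_subset_support K fk hfk' hfkC hfkX)
      (fun Z ρ hρ => isRegular_of_isBlowup_comap K fk hfk' hfkC hfkX Z ρ hρ) υ hυ
  rw [hsupp] at hreg
  rw [hΛ] at hυ
  have hZreg := isRegular_redSub_of_isLiftableNoseClass₂ K 3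
    (IsLiftableNoseClass₂.base _ (SkewLines.line_isLiftableNoseClass K 2 3 0 (by decide) (by decide) (by decide)))
    (WhitneyCubic.isClosed_doubleLine K)
  exact noseHypUnobsBTriplePrime_of_oneBlowup K 3 _ (hypersurfaceι (CuspCone.form K)).left _ (WhitneyCubic.isClosed_doubleLine K)
    (fun x => hZreg x) (P3Line.dirStepUnobs_doubleLine K)
    (doubleLine_subset_range_ι K) (not_range_ι_subset_doubleLine K) (WhitneyCubic.doubleLine_infinite K)
    (WhitneyCubic.doubleLine_curve K) F₂ υ hυ hreg

end CuspCone

end Summit.ResolutionOfSingularities.ResolutionOfSingularities.Cruxes.EquisingularLiftNat.Sections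

end
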